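import Literature.AlgebraicGeometry.HodgeTheory.GriffithsHolomorphicHodgeSubbundlesQP
import HarnessLib

/-!
# The countable analytic cover of the non-Hodge-generic points, with the charts remembered (a `Good` predicate):
# Deligne 1972 Prop. 7.5 in analytic form, granted holomorphic frames of the Hodge bundles in good charts

Family `hodge`, layer `Literature/AlgebraicGeometry/HodgeTheory`. THEOREMS only (no definition, no named fact). Written by the prover
seat `hodge-nonav-19716-p2` (g12, cell `hodge-nonav`) for route `HodgeConjecture/SignSymmetricPowers` (crux K1-B, stmt-HodgeConjecture-19716),
programme «OFF-MEAGRE-B», null sharpening.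

Prover-Ax's chain `hodgeLociAlternative_of_griffiths1968(QP)` → `exists_countable_analyticCover_not_isHodgeGenericPoint_of_griffiths1968(QP)`
(`HodgeGenericPointsCountableOfGriffithsCurve`, `GriffithsHolomorphicHodgeSubbundlesQP`) consumes the named fact
`Griffiths1968_holomorphicHodgeSubbundles(QP)`, whose chart `ψ` is an ABSTRACT homeomorphism onto an open of `ℂ^d`; so the cover sets
`{t ∈ W′ | g (ψ t) = 0}` are only known TOPOLOGICALLY (nowhere dense ⇒ the non-generic locus is meagre, `HodgeGenericPointsComeagreQP`).
For MEASURE statements one must remember WHICH charts occur. This file re-runs the same two proofs VERBATIM with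
(1) the Griffiths input replaced by its conclusion for the given family `f` (hypothesis `hGr`), and (2) an arbitrary predicate
`Good ψ` inserted after `∃ ψ` and carried into the description of the cover sets:

* `hodgeLociAlternative_of_goodFrames` — the local alternative «all of `W`, or inside `{t ∈ W′ | g (ψ t) = 0}` with `Good ψ`»;
* `exists_countable_goodAnalyticCover_not_isHodgeGenericPoint` — a COUNTABLE family `𝒞` of such sets, each nowhere dense, with
  `{t | ¬ IsHodgeGenericPoint} ⊆ ⋃₀ 𝒞`.

With `Good := fun _ ↦ True` and `hGr` := the QP fact applied to `f` these are Ax's statements again; with `Good ψ` := «`ψ` is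
`ComplexPoints.algebraicChart S d t₁` for some `t₁`» (the pinned form of Griffiths' theorem) the cover is by analytic hypersurfaces in
ALGEBRAIC coordinates (pattern of route A's `CyclicUnitaryPowersCyclicSurfacePowersHodgeAlmostAll`, predicate `Good`). Honest scope:
bookkeeping; nothing here says HC or any rung is proved.

## References

* [Deligne1972WeilK3] P. Deligne, La conjecture de Weil pour les surfaces K3, Invent. Math. 15 (1972), Prop. 7.5.
* [VoisinHodgeII2003] C. Voisin, Hodge Theory and Complex Algebraic Geometry II (2003), §5.3.1 Lemma 5.13.
* [VoisinHodgeI2002] C. Voisin, Hodge Theory and Complex Algebraic Geometry I, CUP (2002), §10.2.1 Thm. 10.3.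
-/

noncomputable section

open CategoryTheory AlgebraicGeometry
open _root_.Topology _root_.Filter
open scoped TensorProduct
open Literature.AlgebraicTopology.SingularHomology
open Literature.AlgebraicGeometry.Motives

namespace Literature.AlgebraicGeometry.HodgeTheory

section HodgeTheory

/-- **Hodge loci are cut out by holomorphic equations in GOOD charts, granted holomorphic frames of the Hodge bundles in good
charts** — prover-Ax's `hodgeLociAlternative_of_griffiths1968(QP)` with the Griffiths input replaced by its conclusion FOR THE GIVEN
FAMILY and with an arbitrary predicate `Good` on the charts `ψ` recorded (hypothesis `hGr`: the body of
`Griffiths1968_holomorphicHodgeSubbundlesQP` for `f`, with `Good ψ` inserted after `∃ ψ`): every point `t₁` has arbitrarily small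
path-connected open neighbourhoods `W` on which, for every rational tensor `ζ` and admissible state, the Hodge locus of `ζ` is EITHER
all of `W` OR inside a local analytic hypersurface `{t ∈ W′ | g (ψ t) = 0}` READ IN A GOOD CHART `ψ`, nowhere dense and closed in `W`.
Proof verbatim (Ax): `exists_holomorphicFrame_of_subbundleFrames` + `hodgeLoci_subset_zeroSet_of_holomorphicFrame`.
[cite: VoisinHodgeII2003, §5.3.1 Lemma 5.13] [cite: VoisinHodgeI2002, §10.2.1 Thm. 10.3] [cite: Deligne1972WeilK3, Prop. 7.5] -/
theorem hodgeLociAlternative_of_goodFrames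
    [HodgeTensorFacts.{0, 0}] {𝒳 S : SchemeOver ℂ} (f : 𝒳 ⟶ S) (n k d : ℕ)
    (hf : IsSmoothProjectiveFamily f n) (hS : IsQuasiProjectiveOver S)
    [AlgebraicGeometry.SmoothOfRelativeDimension d S.hom]
    (hU : IsCohomologicallyLocallyTrivialOn f (Set.univ : Set (ComplexPoints S)))
    (A : ∀ t : ComplexPoints S, HodgeModel n (fiberOver f t)) (hA : ∀ t, (A t).IsHodgeSymmetric)
    [∀ t, Module.Finite ℚ (singularCohomology ℚ ℚ (ComplexPoints (fiberOver f t)) k)]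
    (Good : OpenPartialHomeomorph (Set.univ : Set (ComplexPoints S)) (Fin d → ℂ) → Prop)
    (hGr : ∀ (s t₁ : (Set.univ : Set (ComplexPoints S))), ∀ N ∈ 𝓝 t₁,
      ∃ W : Set (Set.univ : Set (ComplexPoints S)), IsOpen W ∧ t₁ ∈ W ∧ W ⊆ N ∧ IsPathConnected W ∧
      ∃ ψ : OpenPartialHomeomorph (Set.univ : Set (ComplexPoints S)) (Fin d → ℂ), Good ψ ∧ W ⊆ ψ.source ∧
      ∀ (T₁ : singularCohomology ℚ ℚ (ComplexPoints (fiberOver f s.1)) k ≃ₗ[ℚ]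
          singularCohomology ℚ ℚ (ComplexPoints (fiberOver f t₁.1)) k),
        (∃ δ₁ : Path.Homotopic.Quotient s t₁,
          ∀ v, ofRatClass _ k (T₁ v) = transportFun f k hU δ₁ (ofRatClass _ k v)) →
        ∀ p : ℤ, ∃ (r : ℕ)
          (w : Fin r → Set.Elem (Set.univ : Set (ComplexPoints S)) →
            ℂ ⊗[ℚ] singularCohomology ℚ ℚ (ComplexPoints (fiberOver f s.1)) k),
          (∀ t ∈ W, ∀ (ε : Path t₁ t), (∀ r', ε r' ∈ W) →
            ∀ (T : singularCohomology ℚ ℚ (ComplexPoints (fiberOver f s.1)) k ≃ₗ[ℚ]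
              singularCohomology ℚ ℚ (ComplexPoints (fiberOver f t.1)) k),
            (∀ v, ofRatClass _ k (T v) = transportFun f k hU ⟦ε⟧ (ofRatClass _ k (T₁ v))) →
            LinearIndependent ℂ (fun i ↦ w i t) ∧
              (((A t.1).hodgeStructure (hf.isSmoothProjective t.1) (hA t.1) k).comapEquiv T).F p =
                Submodule.span ℂ (Set.range fun i ↦ w i t)) ∧
          (∀ (i : Fin r)
            (φ : Module.Dual ℂ (ℂ ⊗[ℚ] singularCohomology ℚ ℚ (ComplexPoints (fiberOver f s.1)) k)),
            AnalyticOnNhd ℂ (fun z ↦ φ (w i (ψ.symm z))) (ψ '' W)))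
    (s t₁ : (Set.univ : Set (ComplexPoints S))) (N : Set (Set.univ : Set (ComplexPoints S)))
    (hN : N ∈ 𝓝 t₁) :
    ∃ W : Set (Set.univ : Set (ComplexPoints S)), IsOpen W ∧ t₁ ∈ W ∧ W ⊆ N ∧ IsPathConnected W ∧
      ∀ (a b : ℕ) (ζ : hodgeTensorSpace (singularCohomology ℚ ℚ (ComplexPoints (fiberOver f
        (Subtype.val s))) k) a b) (x : (Set.univ : Set (ComplexPoints S))),
        x ∈ W → ∀ (Tx : singularCohomology ℚ ℚ (ComplexPoints (fiberOver f (Subtype.val s))) k ≃ₗ[ℚ]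
          singularCohomology ℚ ℚ (ComplexPoints (fiberOver f (Subtype.val x))) k),
        (∃ δ : Path.Homotopic.Quotient s x,
          ∀ v, ofRatClass _ k (Tx v) = transportFun f k hU δ (ofRatClass _ k v)) →
        (∀ t ∈ W, ∀ (ε : Path x t), (∀ r, ε r ∈ W) → ∀ (T : singularCohomology ℚ ℚ (ComplexPoints (fiberOver f
          (Subtype.val s))) k ≃ₗ[ℚ]
          singularCohomology ℚ ℚ (ComplexPoints (fiberOver f (Subtype.val t))) k),
          (∀ v, ofRatClass _ k (T v) = transportFun f k hU ⟦ε⟧ (ofRatClass _ k (Tx v))) →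
          ζ ∈ ((((A t.1).hodgeStructure (hf.isSmoothProjective t.1) (hA t.1) k).comapEquiv T).tensorSpace
            a b).hodgeClasses 0) ∨
        ∃ Z : Set (Set.univ : Set (ComplexPoints S)),
          (∃ (W' : Set (Set.univ : Set (ComplexPoints S)))
            (ψ : OpenPartialHomeomorph (Set.univ : Set (ComplexPoints S)) (Fin d → ℂ)) (g : (Fin d → ℂ) → ℂ),
            Good ψ ∧ IsOpen W' ∧ IsPathConnected W' ∧ W' ⊆ ψ.source ∧ AnalyticOnNhd ℂ g (ψ '' W') ∧
            (∃ t' ∈ W', g (ψ t') ≠ 0) ∧ Z = {t | t ∈ W' ∧ g (ψ t) = 0}) ∧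
          IsNowhereDense Z ∧ (∀ t ∈ W, t ∈ closure Z → t ∈ Z) ∧
        {t : (Set.univ : Set (ComplexPoints S)) | t ∈ W ∧ ∀ (ε : Path x t),
          (∀ r, ε r ∈ W) → ∀ (T : singularCohomology ℚ ℚ (ComplexPoints (fiberOver f (Subtype.val s))) k ≃ₗ[ℚ]
            singularCohomology ℚ ℚ (ComplexPoints (fiberOver f (Subtype.val t))) k),
          (∀ v, ofRatClass _ k (T v) = transportFun f k hU ⟦ε⟧ (ofRatClass _ k (Tx v))) →
          ζ ∈ ((((A t.1).hodgeStructure (hf.isSmoothProjective t.1) (hA t.1) k).comapEquiv T).tensorSpace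
            a b).hodgeClasses 0} ⊆ Z := by
  obtain ⟨W₀, hW₀o, ht₁W₀, hW₀N, hW₀pc, ψ, hgood, hW₀ψ, hfr⟩ := hGr s t₁ N hN
  -- topology of `S(ℂ)`: a manifold, hence locally path connected
  haveI : AlgebraicGeometry.LocallyOfFiniteType S.hom := hS.locallyOfFiniteType
  haveI : AlgebraicGeometry.IsSeparated S.hom := hS.isVarietyPair_ofScheme.isSeparated
  haveI : T2Space (ComplexPoints S) := Literature.NumberTheory.Transcendental.t2Space_algPoints_holds _ ℂ
  letI := Motives.ComplexPoints.chartedSpace S d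
  haveI : LocallyPathConnectedSpace (ComplexPoints S) :=
    ChartedSpace.locallyPathConnectedSpace (EuclideanSpace ℝ (Fin (2 * d))) _
  haveI : LocallyPathConnectedSpace (Set.univ : Set (ComplexPoints S)) :=
    isOpen_univ.locallyPathConnectedSpace
  have hrat : ∀ (x y : (Set.univ : Set (ComplexPoints S))) (γ : Path.Homotopic.Quotient x y)
      (α : complexBetti (fiberOver f x.1) k), IsRationalClass α →
      IsRationalClass (transportFun f k hU γ α) :=
    fun x y γ α hα ↦ isRationalClass_transportFun_of_isSmoothProjectiveFamily f k d hf hS γ hα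
  by_cases hjs : Joined s t₁
  · -- an admissible reference state at `t₁` exists: graded frames on a smaller `W`, then the dichotomy
    obtain ⟨T₁, hT₁⟩ := exists_ratTransport f k hU hrat (⟦hjs.somePath⟧ : Path.Homotopic.Quotient s t₁)
    have hT₁' : ∃ δ₁ : Path.Homotopic.Quotient s t₁,
        ∀ v, ofRatClass _ k (T₁ v) = transportFun f k hU δ₁ (ofRatClass _ k v) := ⟨_, hT₁⟩
    choose r w hw hwhol using hfr T₁ hT₁'
    obtain ⟨W, hWo, ht₁W, hWW₀, hWpc, hW⟩ := exists_holomorphicFrame_of_subbundleFrames f k hU s hrat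
      (fun t ↦ (A t.1).hodgeStructure (hf.isSmoothProjective t.1) (hA t.1) k) hW₀o hW₀pc ψ hW₀ψ
      ht₁W₀ hT₁' r w hw hwhol
    refine ⟨W, hWo, ht₁W, hWW₀.trans hW₀N, hWpc, fun a b ζ x hx Tx hTx ↦ ?_⟩
    obtain ⟨N', deg, e, hF, hol₁, hol₂⟩ := hW x hx Tx hTx
    have hWψ : W ⊆ ψ.source := hWW₀.trans hW₀ψ
    rcases hodgeLoci_subset_zeroSet_of_holomorphicFrame f k hU s hrat
      (fun t ↦ (A t.1).hodgeStructure (hf.isSmoothProjective t.1) (hA t.1) k) hWpc ψ hWψ hx hTx e hF hol₁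
      hol₂ a b ζ with hfull | ⟨g, hg, hne, hsub⟩
    · exact Or.inl hfull
    · exact Or.inr ⟨{t | t ∈ W ∧ g (ψ t) = 0}, ⟨W, ψ, g, hgood, hWo, hWpc, hWψ, hg, hne, rfl⟩,
        isNowhereDense_zeroSet_comp_chart hWo hWpc ψ hWψ hg hne,
        fun t ht htc ↦ mem_zeroSet_comp_chart_of_mem_closure hWo ψ hWψ hg ht htc, hsub⟩
  · -- no admissible state near `t₁`: the condition is void on `W₀`
    refine ⟨W₀, hW₀o, ht₁W₀, hW₀N, hW₀pc, fun a b ζ x hx Tx hTx ↦ ?_⟩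
    exfalso
    obtain ⟨δ, -⟩ := hTx
    induction δ using Quotient.inductionOn with
    | h γ => exact hjs (Joined.trans ⟨γ⟩ (hW₀pc.joinedIn x hx t₁ ht₁W₀).joined)

/-- **The non-Hodge-generic points lie in a COUNTABLE union of local analytic hypersurfaces read in GOOD charts** (Deligne 1972
Prop. 7.5, analytic form; prover-Ax's `exists_countable_analyticCover_not_isHodgeGenericPoint_of_griffiths1968(QP)` with the predicate
`Good` threaded): `exists_countable_cover_not_isHodgeGenericPoint_of_lociAlternative` fed with `hodgeLociAlternative_of_goodFrames`.
With `Good ψ` = «`ψ` is the algebraic chart at some point» (the PINNED form of Griffiths' theorem the cell's programme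
GRIFFITHS-HOLOMORPHY proves) the cover sets are images of analytic zero sets under algebraic charts, hence Lebesgue-null in algebraic
coordinates — the input of the «almost everywhere» readings. [cite: Deligne1972WeilK3, Prop. 7.5] [cite: VoisinHodgeII2003, §5.3.1 Lemma 5.13]
[cite: VoisinHodgeI2002, §10.2.1 Thm. 10.3] -/
theorem exists_countable_goodAnalyticCover_not_isHodgeGenericPoint
    [HodgeTensorFacts.{0, 0}] {𝒳 S : SchemeOver ℂ} (f : 𝒳 ⟶ S) (n k d : ℕ)
    (hf : IsSmoothProjectiveFamily f n) (hS : IsQuasiProjectiveOver S)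
    [AlgebraicGeometry.SmoothOfRelativeDimension d S.hom]
    (hU : IsCohomologicallyLocallyTrivialOn f (Set.univ : Set (ComplexPoints S)))
    (A : ∀ t : ComplexPoints S, HodgeModel n (fiberOver f t)) (hA : ∀ t, (A t).IsHodgeSymmetric)
    [∀ t, Module.Finite ℚ (singularCohomology ℚ ℚ (ComplexPoints (fiberOver f t)) k)]
    (Good : OpenPartialHomeomorph (Set.univ : Set (ComplexPoints S)) (Fin d → ℂ) → Prop)
    (hGr : ∀ (s t₁ : (Set.univ : Set (ComplexPoints S))), ∀ N ∈ 𝓝 t₁,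
      ∃ W : Set (Set.univ : Set (ComplexPoints S)), IsOpen W ∧ t₁ ∈ W ∧ W ⊆ N ∧ IsPathConnected W ∧
      ∃ ψ : OpenPartialHomeomorph (Set.univ : Set (ComplexPoints S)) (Fin d → ℂ), Good ψ ∧ W ⊆ ψ.source ∧
      ∀ (T₁ : singularCohomology ℚ ℚ (ComplexPoints (fiberOver f s.1)) k ≃ₗ[ℚ]
          singularCohomology ℚ ℚ (ComplexPoints (fiberOver f t₁.1)) k),
        (∃ δ₁ : Path.Homotopic.Quotient s t₁,
          ∀ v, ofRatClass _ k (T₁ v) = transportFun f k hU δ₁ (ofRatClass _ k v)) →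
        ∀ p : ℤ, ∃ (r : ℕ)
          (w : Fin r → Set.Elem (Set.univ : Set (ComplexPoints S)) →
            ℂ ⊗[ℚ] singularCohomology ℚ ℚ (ComplexPoints (fiberOver f s.1)) k),
          (∀ t ∈ W, ∀ (ε : Path t₁ t), (∀ r', ε r' ∈ W) →
            ∀ (T : singularCohomology ℚ ℚ (ComplexPoints (fiberOver f s.1)) k ≃ₗ[ℚ]
              singularCohomology ℚ ℚ (ComplexPoints (fiberOver f t.1)) k),
            (∀ v, ofRatClass _ k (T v) = transportFun f k hU ⟦ε⟧ (ofRatClass _ k (T₁ v))) →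
            LinearIndependent ℂ (fun i ↦ w i t) ∧
              (((A t.1).hodgeStructure (hf.isSmoothProjective t.1) (hA t.1) k).comapEquiv T).F p =
                Submodule.span ℂ (Set.range fun i ↦ w i t)) ∧
          (∀ (i : Fin r)
            (φ : Module.Dual ℂ (ℂ ⊗[ℚ] singularCohomology ℚ ℚ (ComplexPoints (fiberOver f s.1)) k)),
            AnalyticOnNhd ℂ (fun z ↦ φ (w i (ψ.symm z))) (ψ '' W))) :
    ∃ 𝒞 : Set (Set (Set.univ : Set (ComplexPoints S))), 𝒞.Countable ∧
      (∀ Z ∈ 𝒞, (∃ (W' : Set (Set.univ : Set (ComplexPoints S)))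
            (ψ : OpenPartialHomeomorph (Set.univ : Set (ComplexPoints S)) (Fin d → ℂ)) (g : (Fin d → ℂ) → ℂ),
            Good ψ ∧ IsOpen W' ∧ IsPathConnected W' ∧ W' ⊆ ψ.source ∧ AnalyticOnNhd ℂ g (ψ '' W') ∧
            (∃ t' ∈ W', g (ψ t') ≠ 0) ∧ Z = {t | t ∈ W' ∧ g (ψ t) = 0}) ∧ IsNowhereDense Z) ∧
      {t : (Set.univ : Set (ComplexPoints S)) | ¬ IsHodgeGenericPoint f k hU hf A hA t} ⊆ ⋃₀ 𝒞 :=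
  exists_countable_cover_not_isHodgeGenericPoint_of_lociAlternative f n k d hf hS hU A hA
    (fun Z ↦ (∃ (W' : Set (Set.univ : Set (ComplexPoints S)))
            (ψ : OpenPartialHomeomorph (Set.univ : Set (ComplexPoints S)) (Fin d → ℂ)) (g : (Fin d → ℂ) → ℂ),
            Good ψ ∧ IsOpen W' ∧ IsPathConnected W' ∧ W' ⊆ ψ.source ∧ AnalyticOnNhd ℂ g (ψ '' W') ∧
            (∃ t' ∈ W', g (ψ t') ≠ 0) ∧ Z = {t | t ∈ W' ∧ g (ψ t) = 0}))
    fun s t₁ N hN ↦ hodgeLociAlternative_of_goodFrames f n k d hf hS hU A hA Good hGr s t₁ N hN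

end HodgeTheory

end Literature.AlgebraicGeometry.HodgeTheory

end
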